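import Mathlib
import Summits.ValiantsHypothesis.ValiantsHypothesis.Theorems.BinomialElusiveBinomialCandidateCrossCapIteration

/-!
# Crux `BinomialElusive.BinomialCandidate` (stmt-ValiantsHypothesis-7392), line `registered`,
# skeleton v5 — stub `stub_shallowCorankOne`, piece 2: Picard elimination with the kernel-curve jet

This file proves the registered helper stub `corankOne_iteration`, the generalisation of
`crossCap_iteration` (piece 3 of `stub_crossCap`, file `…CrossCapIteration`) from the 2-jet to
the `d₁`-jet.

Corank-one data in normal form: source variables `Y_0 = x` (the kernel direction) and
`Y_1, …, Y_{n₀}` (regular), target variables `W_0, W_1` (special) and `W_2, …, W_{n₀+1}`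
(regular, `W_{j+1} ↔ Y_j`), polynomials `B_i(Y)` without monomials of degree `< 2`, and
Laurent series `q_j(t)`, `T_i(t)` of positive order with `q_j + B_{j+1}(q) = T_{j+1}` for the
regular indices, `B_0(q) = T_0`, `B_1(q) = T_1`.

`corankOne_iteration`: for all `G, d₁` there are polynomials `F₀, F₁ ∈ ℂ[W][X]` and a jet
`φ = (φ_1, …, φ_{n₀})`, `φ_j ∈ ℂ[x]`, with

* `F_a(T(t), q_0(t)) ≡ 0 (mod t^G)`;
* the coefficient of `W_b` in `f_{a,0}` is `-δ_{ab}` (`a, b ∈ {0, 1}`), where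
  `F_a = Σ_j f_{a,j}(W) X^j`;
* `φ_j = O(x²)` and `φ_j + B_{j+1}(x, φ(x)) ≡ 0 (mod x^{d₁+1})` (so `φ` is the `d₁`-jet of the
  formal kernel curve `Y_0 = x`, `Y_j = φ_j(x)`);
* `f_{a,j}(0) = [x^j] B_a(x, φ(x))` for `j ≤ d₁`.

Construction (as in the template, with more iterations): `F_a := B_a(Φ_K(W', X)) - W_a`,
`K = G + d₁ + 1`, where `Φ_K` is the `K`-th Picard iterate of `Y ↦ W' - B'(Y)`
(`B' := (0, B_2, …, B_{n₀+1})`) and `W'` substitutes `W_{j+1}` for `Y_j` (`j ≥ 1`) and keeps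
`X = Y_0`; the `t`-adic congruence is CLAIM A (`JetReduction.filt_sub_aeval_iter`) exactly as in
the template.  New: `φ_j := Φ_K(x, 0, …, 0)_j`, the restriction of the iterate to the axis
(`CorankOneIteration.coeff_aeval_axis`: `[x^k] H(x, 0, …, 0) = coeff_{Y_0^k} H`).  Since
`B'_0 = 0` every iterate keeps `Y_0`, so `B_a(x, φ(x)) = B_a(Φ_K)(x, 0, …, 0)`, which gives the
formula for `f_{a,j}(0)`; `φ_j = -B'_j(Φ_{K-1})(x, 0, …)` has order `≥ 2`; and
`φ_j + B_{j+1}(x, φ) = (Φ_K - Φ_{K+1})_j (x, 0, …, 0)` vanishes below degree `K + 2 > d₁`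
because successive iterates agree to increasing order (`Φ_{m+1} ≡ Φ_m (mod degree ≥ m + 2)`,
induction with `JetReduction.aeval_sub_aeval_degGE`).
-/

-- layout Summits/ValiantsHypothesis/ValiantsHypothesis forces the duplicated namespace component
set_option linter.dupNamespace false

noncomputable section

namespace Summit.ValiantsHypothesis.ValiantsHypothesis.Theorems.BinomialCandidateStubs

open scoped BigOperators
open MvPolynomial

namespace CorankOneIteration

variable {n₀ : ℕ}

/-- The axis substitution `Y_0 ↦ X`, `Y_{j+1} ↦ 0` is `finSuccEquiv` followed by evaluating the
coefficients at `0`. -/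
theorem aeval_axis_eq (H : MvPolynomial (Fin (n₀ + 1)) ℂ) :
    MvPolynomial.aeval (Fin.cons Polynomial.X fun _ : Fin n₀ => (0 : Polynomial ℂ)) H =
      Polynomial.map (MvPolynomial.aeval fun _ : Fin n₀ => (0 : ℂ)).toRingHom
        (MvPolynomial.finSuccEquiv ℂ n₀ H) := by
  set Ψ : MvPolynomial (Fin (n₀ + 1)) ℂ →ₐ[ℂ] Polynomial ℂ :=
    (Polynomial.mapAlgHom (MvPolynomial.aeval fun _ : Fin n₀ => (0 : ℂ))).comp
      (MvPolynomial.finSuccEquiv ℂ n₀).toAlgHom with hΨ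
  have h1 : Ψ =
      MvPolynomial.aeval (Fin.cons Polynomial.X fun _ : Fin n₀ => (0 : Polynomial ℂ)) := by
    refine MvPolynomial.algHom_ext fun i => ?_
    refine Fin.cases ?_ (fun j' => ?_) i
    · simp [hΨ, Polynomial.coe_mapAlgHom, MvPolynomial.finSuccEquiv_X_zero]
    · simp [hΨ, Polynomial.coe_mapAlgHom, MvPolynomial.finSuccEquiv_X_succ]
  have := congrArg (fun φ => φ H) h1
  simpa [hΨ, Polynomial.coe_mapAlgHom] using this.symm

/-- Coefficients of the axis restriction: `[x^k] H(x, 0, …, 0) = coeff_{Y_0^k} H`. -/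
theorem coeff_aeval_axis (H : MvPolynomial (Fin (n₀ + 1)) ℂ) (k : ℕ) :
    (MvPolynomial.aeval (Fin.cons Polynomial.X fun _ : Fin n₀ => (0 : Polynomial ℂ)) H).coeff k =
      MvPolynomial.coeff (Finsupp.single 0 k) H := by
  rw [aeval_axis_eq, Polynomial.coeff_map, AlgHom.toRingHom_eq_coe, RingHom.coe_coe,
    MvPolynomial.aeval_zero', Algebra.algebraMap_self_apply, MvPolynomial.constantCoeff_eq,
    MvPolynomial.finSuccEquiv_coeff_coeff, Finsupp.cons_zero_eq_single_zero]

end CorankOneIteration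

open CrossCap CorankOneIteration in
/-- **Elimination of the regular coordinates with the kernel-curve jet** (piece 2 of the stub
`stub_shallowCorankOne`).  In the corank-one normal form (`B_i` without monomials of degree
`< 2`; `q`, `T` of positive order; `q_j + B_{j+1}(q) = T_{j+1}` for the regular indices,
`B_0(q) = T_0`, `B_1(q) = T_1`), for all `G, d₁` there are `F₀, F₁ ∈ ℂ[W][X]` and
`φ : Fin n₀ → ℂ[x]` with `F_a(T, q_0) ≡ 0 (mod t^G)`, `coeff_{W_b} f_{a,0} = -δ_{ab}`
(`a, b ∈ {0,1}`), `φ_j = O(x²)`, `φ_j + B_{j+1}(x, φ(x)) ≡ 0 (mod x^{d₁+1})` and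
`f_{a,j}(0) = [x^j] B_a(x, φ(x))` for `j ≤ d₁`. -/
theorem corankOne_iteration :
    ∀ (n₀ G d₁ : ℕ) (B : Fin (n₀ + 2) → MvPolynomial (Fin (n₀ + 1)) ℂ)
      (q : Fin (n₀ + 1) → LaurentSeries ℂ) (T : Fin (n₀ + 2) → LaurentSeries ℂ),
      (∀ i, ∀ d : Fin (n₀ + 1) →₀ ℕ, d.degree < 2 → MvPolynomial.coeff d (B i) = 0) →
      (∀ j, ∀ g : ℤ, g < 1 → (q j).coeff g = 0) →
      (∀ i, ∀ g : ℤ, g < 1 → (T i).coeff g = 0) →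
      (∀ j' : Fin n₀, q j'.succ + MvPolynomial.aeval q (B j'.succ.succ) = T j'.succ.succ) →
      MvPolynomial.aeval q (B 0) = T 0 →
      MvPolynomial.aeval q (B 1) = T 1 →
      ∃ (F₀ F₁ : Polynomial (MvPolynomial (Fin (n₀ + 2)) ℂ)) (φ : Fin n₀ → Polynomial ℂ),
        (∀ g : ℤ, g < G →
          (Polynomial.eval₂ (MvPolynomial.aeval T).toRingHom (q 0) F₀).coeff g = 0) ∧
        (∀ g : ℤ, g < G →
          (Polynomial.eval₂ (MvPolynomial.aeval T).toRingHom (q 0) F₁).coeff g = 0) ∧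
        MvPolynomial.coeff (Finsupp.single 0 1) (F₀.coeff 0) = -1 ∧
        MvPolynomial.coeff (Finsupp.single 1 1) (F₀.coeff 0) = 0 ∧
        MvPolynomial.coeff (Finsupp.single 0 1) (F₁.coeff 0) = 0 ∧
        MvPolynomial.coeff (Finsupp.single 1 1) (F₁.coeff 0) = -1 ∧
        (∀ j', (φ j').coeff 0 = 0 ∧ (φ j').coeff 1 = 0) ∧
        (∀ j' : Fin n₀, ∀ n ≤ d₁,
          (φ j' + MvPolynomial.aeval (Fin.cons Polynomial.X φ) (B j'.succ.succ)).coeff n = 0) ∧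
        (∀ j ≤ d₁, MvPolynomial.constantCoeff (F₀.coeff j) =
          (MvPolynomial.aeval (Fin.cons Polynomial.X φ) (B 0)).coeff j) ∧
        (∀ j ≤ d₁, MvPolynomial.constantCoeff (F₁.coeff j) =
          (MvPolynomial.aeval (Fin.cons Polynomial.X φ) (B 1)).coeff j) := by
  intro n₀ G d₁ B q T hB hq hT hreg h0 h1
  -- the `t`-adic filtration of `ℂ((t))`
  have hF := JetReduction.laurentGE_isFilt
  set F : ℕ → LaurentSeries ℂ → Prop := fun m z => ∀ g : ℤ, g < m → z.coeff g = 0 with hFdef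
  -- the fixed-point system `q_j = W_j - B'_j(q)` on all `n₀ + 1` source variables
  set Bs : Fin (n₀ + 1) → MvPolynomial (Fin (n₀ + 1)) ℂ := Fin.cons 0 (fun j' => B j'.succ.succ)
    with hBs_def
  set W : Fin (n₀ + 1) → LaurentSeries ℂ := Fin.cons (q 0) (fun j' => T j'.succ.succ) with hW_def
  have hBs : ∀ j, ∀ d : Fin (n₀ + 1) →₀ ℕ, d.degree < 2 → coeff d (Bs j) = 0 :=
    Fin.cases (fun d _ => by simp [hBs_def]) (fun j' => by simpa [hBs_def] using hB j'.succ.succ)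
  have hq' : ∀ j, F 1 (q j) := fun j g hg => hq j g (by exact_mod_cast hg)
  have hT' : ∀ i, F 1 (T i) := fun i g hg => hT i g (by exact_mod_cast hg)
  have hW : ∀ j, F 1 (W j) :=
    Fin.cases (by simpa [hW_def] using hq' 0) (fun j' => by simpa [hW_def] using hT' j'.succ.succ)
  have hfix : ∀ j, q j = W j - aeval q (Bs j) :=
    Fin.cases (by simp [hW_def, hBs_def]) (fun j' => by
      simp only [hW_def, hBs_def, Fin.cons_succ]
      rw [← hreg j']
      ring)
  -- the Picard iterates
  set Φ : ℕ → Fin (n₀ + 1) → MvPolynomial (Fin (n₀ + 1)) ℂ :=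
    fun m => (fun (Ψ : Fin (n₀ + 1) → MvPolynomial (Fin (n₀ + 1)) ℂ) (j : Fin (n₀ + 1)) =>
      X j - aeval Ψ (Bs j))^[m] X with hΦdef
  have hΦ0 : ∀ j, Φ 0 j = X j := fun j => rfl
  have hΦ : ∀ m j, Φ (m + 1) j = X j - aeval (Φ m) (Bs j) := fun m j => by
    simp only [hΦdef, Function.iterate_succ_apply']
  -- the iterates keep the kernel coordinate: `(Φ_m)_0 = Y_0` (as `B'_0 = 0`)
  have hΦzero : ∀ m, Φ m 0 = X 0 := by
    intro m
    induction m with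
    | zero => exact hΦ0 0
    | succ m _ => rw [hΦ]; simp [hBs_def]
  -- successive iterates agree to increasing order: `Φ_{m+1} ≡ Φ_m (mod degree ≥ m + 2)`
  have hdiff : ∀ m j, ∀ e : Fin (n₀ + 1) →₀ ℕ, e.degree < m + 2 →
      coeff e (Φ (m + 1) j - Φ m j) = 0 := by
    intro m
    induction m with
    | zero =>
      intro j e he
      rw [hΦ, hΦ0, sub_sub_cancel_left, coeff_neg, neg_eq_zero]
      exact JetReduction.aeval_degGE (hBs j) (JetReduction.iter_degGE_one hBs hΦ0 hΦ 0) e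
        (by omega)
    | succ m ih =>
      intro j
      rw [hΦ (m + 1) j, hΦ m j, sub_sub_sub_cancel_left]
      exact JetReduction.aeval_sub_aeval_degGE (t := m + 1) (hBs j)
        (JetReduction.iter_degGE_one hBs hΦ0 hΦ m)
        (JetReduction.iter_degGE_one hBs hΦ0 hΦ (m + 1))
        (fun i e he => by rw [← neg_sub, coeff_neg, ih i e (by omega), neg_zero])
  -- CLAIM A: `q ≡ Φ_m(W)` to level `m + 2`
  have hA : ∀ m j, F (m + 2) (q j - aeval W (Φ m j)) :=
    JetReduction.filt_sub_aeval_iter hF hBs hΦ0 hΦ hq' hW hfix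
  -- the polynomials `B_a(Φ_K)`, `K = G + d₁ + 1`
  set Gp : Fin (n₀ + 2) → MvPolynomial (Fin (n₀ + 1)) ℂ :=
    fun a => aeval (Φ (G + d₁ + 1)) (B a) with hGp_def
  -- CLAIM B: `B_a(Φ_K(W)) ≡ B_a(q)` to level `K + 3`
  have hBval : ∀ a, F (G + d₁ + 1 + 1 + 2) (aeval W (Gp a) - aeval q (B a)) := by
    intro a
    rw [hGp_def, JetReduction.aeval_aeval]
    exact JetReduction.filt_aeval_sub_aeval hF (hB a)
      (fun j => JetReduction.filt_aeval_iter hF hBs hΦ0 hΦ hW (G + d₁ + 1) j) hq'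
      (G + d₁ + 1 + 1)
      (fun j => by
        have h := hF.2.2.1 (G + d₁ + 1 + 2) _ (hA (G + d₁ + 1) j)
        rw [neg_sub] at h
        exact h)
  -- the polynomials `F_a := B_a(Φ_K(W', X)) - W_a`
  have hev : ∀ a, aeval q (B a) = T a →
      ∀ g : ℤ, g < G → (Polynomial.eval₂ (MvPolynomial.aeval T).toRingHom (q 0)
        (Polynomial.map (MvPolynomial.rename (fun j' : Fin n₀ => j'.succ.succ)).toRingHom
          (MvPolynomial.finSuccEquiv ℂ n₀ (Gp a)) - Polynomial.C (X a))).coeff g = 0 := by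
    intro a ha g hg
    rw [Polynomial.eval₂_sub, eval₂_embed, Polynomial.eval₂_C]
    have := hBval a g (by push_cast; omega)
    simpa [ha, hW_def] using this
  have hcc : ∀ a (j : ℕ), MvPolynomial.constantCoeff
      ((Polynomial.map (MvPolynomial.rename (fun j' : Fin n₀ => j'.succ.succ)).toRingHom
        (MvPolynomial.finSuccEquiv ℂ n₀ (Gp a)) - Polynomial.C (X a)).coeff j) =
      coeff (Finsupp.single 0 j) (Gp a) := by
    intro a j
    rw [Polynomial.coeff_sub, map_sub, constantCoeff_coeff_embed, Polynomial.coeff_C]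
    split_ifs <;> simp
  have hlin : ∀ a b : Fin (n₀ + 2), b = 0 ∨ b = 1 → MvPolynomial.coeff (Finsupp.single b 1)
      ((Polynomial.map (MvPolynomial.rename (fun j' : Fin n₀ => j'.succ.succ)).toRingHom
        (MvPolynomial.finSuccEquiv ℂ n₀ (Gp a)) - Polynomial.C (X a)).coeff 0) =
      if a = b then -1 else 0 := by
    intro a b hb
    classical
    rw [Polynomial.coeff_sub, coeff_sub,
      coeff_single_coeff_embed _ _ _ (fun j' => succ_succ_ne j' b hb),
      Polynomial.coeff_C_zero, coeff_X, zero_sub]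
    by_cases hab : a = b
    · subst hab; simp
    · rw [if_neg (fun h => hab (Finsupp.single_left_injective one_ne_zero h)), if_neg hab, neg_zero]
  -- the kernel-curve jet: the iterate `Φ_K` restricted to the axis `Y = (x, 0, …, 0)`
  obtain ⟨φ, hφ_def⟩ : ∃ φ : Fin n₀ → Polynomial ℂ, φ = fun j' =>
      aeval (Fin.cons Polynomial.X fun _ : Fin n₀ => (0 : Polynomial ℂ))
        (Φ (G + d₁ + 1) j'.succ) := ⟨_, rfl⟩
  have hφ : ∀ j', φ j' = aeval (Fin.cons Polynomial.X fun _ : Fin n₀ => (0 : Polynomial ℂ))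
      (Φ (G + d₁ + 1) j'.succ) := fun j' => by rw [hφ_def]
  have hcons : (Fin.cons Polynomial.X φ : Fin (n₀ + 1) → Polynomial ℂ) = fun i =>
      aeval (Fin.cons Polynomial.X fun _ : Fin n₀ => (0 : Polynomial ℂ)) (Φ (G + d₁ + 1) i) := by
    funext i
    refine Fin.cases ?_ (fun j' => ?_) i
    · rw [Fin.cons_zero, hΦzero, aeval_X, Fin.cons_zero]
    · rw [Fin.cons_succ, hφ]
  have hcomp : ∀ H : MvPolynomial (Fin (n₀ + 1)) ℂ, aeval (Fin.cons Polynomial.X φ) H =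
      aeval (Fin.cons Polynomial.X fun _ : Fin n₀ => (0 : Polynomial ℂ))
        (aeval (Φ (G + d₁ + 1)) H) := by
    intro H
    rw [hcons, JetReduction.aeval_aeval]
  -- `φ = O(x²)`
  have h7 : ∀ j', (φ j').coeff 0 = 0 ∧ (φ j').coeff 1 = 0 := by
    intro j'
    have hdeg : ∀ e : Fin (n₀ + 1) →₀ ℕ, e.degree < 2 →
        coeff e (aeval (Φ (G + d₁)) (Bs j'.succ)) = 0 :=
      JetReduction.aeval_degGE (hBs _) (JetReduction.iter_degGE_one hBs hΦ0 hΦ _)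
    have hφj : φ j' = -aeval (Fin.cons Polynomial.X fun _ : Fin n₀ => (0 : Polynomial ℂ))
        (aeval (Φ (G + d₁)) (Bs j'.succ)) := by
      rw [hφ, hΦ, map_sub, aeval_X, Fin.cons_succ, zero_sub]
    refine ⟨?_, ?_⟩
    · rw [hφj, Polynomial.coeff_neg, coeff_aeval_axis, hdeg (Finsupp.single 0 0) (by simp),
        neg_zero]
    · rw [hφj, Polynomial.coeff_neg, coeff_aeval_axis, hdeg (Finsupp.single 0 1) (by simp),
        neg_zero]
  -- the kernel-curve congruence `φ_j + B_{j+1}(x, φ) ≡ 0 (mod x^{d₁+1})`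
  have h8 : ∀ j' : Fin n₀, ∀ n ≤ d₁,
      (φ j' + aeval (Fin.cons Polynomial.X φ) (B j'.succ.succ)).coeff n = 0 := by
    intro j' n hn
    have hB' : B j'.succ.succ = Bs j'.succ := by simp [hBs_def]
    have key : φ j' + aeval (Fin.cons Polynomial.X φ) (B j'.succ.succ) =
        -aeval (Fin.cons Polynomial.X fun _ : Fin n₀ => (0 : Polynomial ℂ))
          (Φ (G + d₁ + 1 + 1) j'.succ - Φ (G + d₁ + 1) j'.succ) := by
      rw [hcomp, hB', hΦ (G + d₁ + 1) j'.succ, map_sub, map_sub, aeval_X, Fin.cons_succ,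
        zero_sub, hφ]
      ring
    rw [key, Polynomial.coeff_neg, coeff_aeval_axis,
      hdiff (G + d₁ + 1) j'.succ (Finsupp.single 0 n) (by rw [Finsupp.degree_single]; omega),
      neg_zero]
  refine ⟨_, _, φ, hev 0 h0, hev 1 h1, ?_, ?_, ?_, ?_, h7, h8, ?_, ?_⟩
  · rw [hlin 0 0 (Or.inl rfl), if_pos rfl]
  · rw [hlin 0 1 (Or.inr rfl), if_neg Fin.zero_ne_one]
  · rw [hlin 1 0 (Or.inl rfl), if_neg Fin.zero_ne_one.symm]
  · rw [hlin 1 1 (Or.inr rfl), if_pos rfl]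
  · intro j _
    rw [hcc, hcomp, coeff_aeval_axis]
  · intro j _
    rw [hcc, hcomp, coeff_aeval_axis]

end Summit.ValiantsHypothesis.ValiantsHypothesis.Theorems.BinomialCandidateStubs

end
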